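import Literature.NumberTheory.Sieve.MaynardSieveYm
import Literature.NumberTheory.Sieve.GoldstonGrahamPintzYildirimProofs
import Literature.NumberTheory.Sieve.GoldstonGrahamPintzYildirimLemma3
import HarnessLib

/-!
# Maynard 2015, proof of Lemma 6.3: the evaluation (6.10) of `y^{(m)}` is unconditional

Topic `Literature/NumberTheory/Sieve`. Assembly (theorems only, no new definitions) of three files,
recording by name the discharge of two named facts:

* `GoldstonGrahamPintzYildirimLemma3.lean`: `GGPY.moebiusSqGSum_asymptotic_holds` — Goldston–Graham–
  Pintz–Yıldırım 2009, Lemma 3 with `κ = 1` (Halberstam–Richert, Lemmas 5.3–5.4), PROVED;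
* `GoldstonGrahamPintzYildirimProofs.lean`: `GGPY.moebiusSqGSumWeighted_asymptotic_of` — Lemma 4
  from Lemma 3 by partial summation, PROVED;
* `MaynardSieveYm.lean`: `maynard_lemma63_ym_of_GGPY` — Maynard's display (6.10) (the uniform
  evaluation of `y^{(m)}` in the proof of Lemma 6.3) from Lemma 4 (= Maynard's Lemma 6.1), PROVED.

Hence `GGPY.moebiusSqGSumWeighted_asymptotic_holds` (the named fact
`Literature.NumberTheory.Sieve.GGPY.moebiusSqGSumWeighted_asymptotic` of `GoldstonGrahamPintzYildirim.lean` = Maynard's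
Lemma 6.1 in the form he uses, DISCHARGED) and `maynard_lemma63_ym_holds` (the named fact
`Literature.NumberTheory.Sieve.maynard_lemma63_ym` of `MaynardSieveS2.lean`, DISCHARGED). The same terms appear inline in
`Literature.NumberTheory.Sieve.maynard_S2_asymptotic_holds` (`MaynardTaoTheoremProofs.lean`) and in
`Literature.NumberTheory.Sieve.frequently_nth_prime_succ_le_add_maynard_holds` (`ParityWave0MaynardHolds.lean`).

## References

* J. Maynard, *Small gaps between primes*, Ann. of Math. (2) 181 (2015), 383–413,
  doi:10.4007/annals.2015.181.1.7 = arXiv:1311.4600: Lemmas 6.1, 6.3 and display (6.10),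
  pp. 13–14. [MaynardAnnals2015]
* D. A. Goldston, S. W. Graham, J. Pintz, C. Y. Yıldırım, *Small gaps between products of two
  primes*, Proc. Lond. Math. Soc. (3) 98 (2009), 741–774, Lemmas 3, 4. [GoldstonEtAl2008]
-/

namespace Literature.NumberTheory.Sieve

/-- **Goldston–Graham–Pintz–Yıldırım 2009, Lemma 4 (`κ = 1`) = Maynard 2015, Lemma 6.1, PROVED**:
`∑_{d<z} μ(d)² g(d) F(log(z/d)/log z) = c_γ (log z) ∫₀¹ F(1−x) dx + O_{A₁,A₂}(c_γ L M(F))` under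
`(Ω₁)`, `(Ω₂(1, L))` (Lemma 3 is `GGPY.moebiusSqGSum_asymptotic_holds`, Lemma 4 from Lemma 3 is
`GGPY.moebiusSqGSumWeighted_asymptotic_of`).
[cite: GoldstonEtAl2008, Lemma 4 (κ = 1)] [cite: MaynardAnnals2015, Lemma 6.1] -/
theorem GGPY.moebiusSqGSumWeighted_asymptotic_holds : GGPY.moebiusSqGSumWeighted_asymptotic :=
  GGPY.moebiusSqGSumWeighted_asymptotic_of GGPY.moebiusSqGSum_asymptotic_holds

/-- **Maynard 2015, proof of Lemma 6.3, display (6.10), PROVED**: the named fact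
`maynard_lemma63_ym` — for `r_m = 1` and `r` good,
`y^{(m)}_r = (log R)(φ(W)/W)(∏ᵢ φ(rᵢ)/rᵢ) F^{(m)}_r + O(F_max φ(W) log R/(W D₀))` uniformly in `r` —
holds unconditionally (`maynard_lemma63_ym_of_GGPY` fed with Lemma 6.1).
[cite: MaynardAnnals2015, proof of Lemma 6.3, display (6.10)] -/
theorem maynard_lemma63_ym_holds : maynard_lemma63_ym :=
  maynard_lemma63_ym_of_GGPY GGPY.moebiusSqGSumWeighted_asymptotic_holds

end Literature.NumberTheory.Sieve
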